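import Mathlib
import Literature.AlgebraicGeometry.Resolution.PIndependence
import Literature.FieldTheory.Separability.PIndependentDerivations
import HarnessLib

/-!
# Crux `Steer` (stmt-ResolutionOfSingularities-16345), chain W4.1, σ-line input **P `FGFieldPBasisDual`**:
# dual derivations of a `p`-basis — a finite derivation family with common kernel exactly `F^p`

OURS (campaign `res-hironaka`, rung L, slot W4.1, chain W4.1; replaces the role of no printed item; NOT a
statement of the manuscript under review; AI review is weaker than expert review). Theses-free helper for
the finite-`p`-rank re-typing of the K-slots of the line `Cruxes/Steer/Lines/switching_dichotomy.lean`
(holder res-L0-w41-lead-1, r20; res-L0-w41-plan-1 `R2TwoSigma-r19.snippet.lean` v8 §σ2.11, ORDER P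
2026-08-27T05:50:42Z): the dischargeable field-theory kernel

> **P.** For a prime `p`, a perfect field `k` of characteristic `p` and a field `F ⊇ k` finitely generated
> over `k`, there are finitely many derivations `D₁, …, D_e ∈ Der(F)` with
> `⋂ ker Dₗ = F^p = {y ^ p | y ∈ F}`.

consumed by `GeoDictFin` (the residue field of the first member of an isolated radicand chain is a finitely
generated extension of the perfect ground field) to feed `NoEternalIsolatedRadicandChainFin p c`.

## Proof (namespace `…Theorems.SwitchingDichotomy.PBasisDual`)

Everything rests on the tree's `Literature/FieldTheory/Separability/PIndependentDerivations.lean`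
(Matsumura §26, p. 202: maps on a `p`-basis extend to derivations):

* `pAdjoin_eq_top_of_adjoin_eq_top` — if `F = k(T)` with `k` perfect then `F = F^p(T)` (`k = k^p ⊆ F^p`);
* a finite generating set `T` contains a `p`-free `S` with `F = F^p(S)` (`exists_isPFree_subset`), and a
  `p`-free `S` has dual derivations `∂_s` (`exists_dual_derivation`);
* `mem_frobenius_of_forall_dual_eq_zero` — **common kernel ⊆ `F^p`**: by the expansion
  `d z = Σ_{s ∈ S} ∂_s(z) · d(s)` (`derivation_apply_eq_sum_dual`) an element killed by every `∂_s` is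
  killed by EVERY derivation of `F`; but an element outside `F^p` is detected by some derivation
  (`exists_derivation_eq_one_eqOn_zero` with zero set `F^p`);
* `⊇` — derivations kill `p`-th powers (`Derivation.apply_pow_char`).

Main statements: `exists_derivation_commonKernel_of_fg` (hypothesis `(⊤ : IntermediateField k F).FG`),
`exists_derivation_commonKernel` (`[Algebra.EssFiniteType k F]`), the consumer shapes
`exists_derivation_commonKernel_residueField` (residue field of a local ring essentially of finite type
over `k`) and `exists_derivation_commonKernel_residueField_atPrime` (localisation of a finitely generated
`k`-algebra at a prime), `of_ringEquiv` (transport of the datum along a ring isomorphism, for consumers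
whose residue field is presented up to `≃+*`), and the LITERAL
`fgFieldPBasisDual : <body of the snippet's FGFieldPBasisDual>` (closes P by `exact`).

Elementary; no named facts, no definitions. [cite: Matsumura1987, §26 p. 202 (p-bases and derivations),
Thm. 26.5] [folklore]
-/

noncomputable section

-- `Summit.<S>.<S>.…` duplicates the summit name by design (single-problem summit).
set_option linter.dupNamespace false

namespace Summit.ResolutionOfSingularities.ResolutionOfSingularities.Theorems.SwitchingDichotomy.PBasisDual

open Literature.FieldTheory.Separability

universe u v w

variable {k : Type u} {F : Type v} [Field k] [Field F] [Algebra k F] (p : ℕ) [Fact p.Prime] [CharP F p]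

/-- Over a perfect field `k ⊆ F` (characteristic `p`): if `F = k(T)` as a field then `F = F^p(T)`, because
`k = k^p ⊆ F^p`. [cite: Matsumura1987, §26 p. 203] [folklore] -/
theorem pAdjoin_eq_top_of_adjoin_eq_top [PerfectField k] {T : Set F}
    (hT : IntermediateField.adjoin k T = ⊤) : pAdjoin p T = ⊤ := by
  haveI : CharP k p := (algebraMap k F).charP (algebraMap k F).injective p
  haveI : PerfectRing k p := PerfectField.toPerfectRing p
  rw [eq_top_iff]
  intro z _
  have hz : z ∈ (IntermediateField.adjoin k T).toSubfield := by
    rw [hT]; trivial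
  rw [IntermediateField.adjoin_toSubfield] at hz
  refine (Subfield.closure_le.mpr ?_) hz
  rintro x (⟨c, rfl⟩ | hx)
  · -- `algebraMap k F c = (algebraMap k F c')^p` with `c' = c^{1/p}`
    have : algebraMap k F c = (algebraMap k F ((frobeniusEquiv k p).symm c)) ^ p := by
      rw [← map_pow, frobeniusEquiv_symm_pow_p]
    rw [this]
    exact pow_mem_pAdjoin _ _
  · exact subset_pAdjoin _ hx

/-- **Common kernel ⊆ `F^p`.** If a finite family `S ⊆ F` with `F = F^p(S)` carries dual derivations
`∂_s` (`∂_s s = 1`, `∂_s t = 0` for `t ≠ s` in `S`), then every `z` with `∂_s z = 0` for all `s ∈ S` is a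
`p`-th power: every derivation `d` of `F` satisfies `d z = Σ_s ∂_s(z) · d(s) = 0`, while an element outside
`F^p` has a derivation with `d z = 1`. [cite: Matsumura1987, §26 p. 202] [folklore] -/
theorem mem_frobenius_of_forall_dual_eq_zero {S : Finset F} {δ : F → Derivation ℤ F F}
    (hδ : ∀ s ∈ S, δ s s = 1 ∧ ∀ t ∈ S, t ≠ s → δ s t = 0)
    (hS : pAdjoin p (↑S : Set F) = ⊤) {z : F} (hz : ∀ s ∈ S, δ s z = 0) : ∃ y : F, y ^ p = z := by
  by_contra hne
  have hzF : z ∉ (frobenius F p).fieldRange := fun h => by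
    obtain ⟨y, hy⟩ := RingHom.mem_fieldRange.mp h
    exact hne ⟨y, by rw [← hy, frobenius_def]⟩
  obtain ⟨d, hd1, -⟩ := exists_derivation_eq_one_eqOn_zero p (frobenius F p).fieldRange
    (fun x => RingHom.mem_fieldRange.mpr ⟨x, frobenius_def ..⟩) hzF
  have hzS : z ∈ pAdjoin p (↑S : Set F) := by rw [hS]; trivial
  have hsum := derivation_apply_eq_sum_dual (p := p) hδ d hzS
  rw [hd1, Finset.sum_eq_zero fun s hs => by rw [hz s hs, zero_smul]] at hsum
  exact one_ne_zero hsum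

omit [Fact p.Prime] in
/-- Derivations kill `p`-th powers: the easy inclusion `F^p ⊆ ker D`. [folklore] -/
theorem apply_eq_zero_of_pow_eq (D : Derivation ℤ F F) {z y : F} (hy : y ^ p = z) : D z = 0 := by
  rw [← hy]
  exact Derivation.apply_pow_char (p := p) D y

/-- **P, finitely-generated-field form.** For a field `F` of characteristic `p` finitely generated (as a
field) over a perfect subfield `k`, there is a finite family of derivations `D : Fin e → Der(F)` whose
common kernel is exactly the set of `p`-th powers. (Take a `p`-free subset `S` of a finite generating set
with `F = F^p(S)` and its dual derivations.) [cite: Matsumura1987, §26 p. 202 and Thm. 26.5] [folklore] -/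
theorem exists_derivation_commonKernel_of_fg [PerfectField k]
    (hfg : (⊤ : IntermediateField k F).FG) :
    ∃ (e : ℕ) (D : Fin e → Derivation ℤ F F), ∀ z : F, (∀ l, D l z = 0) ↔ ∃ y : F, y ^ p = z := by
  classical
  obtain ⟨T, hT⟩ := hfg
  have hTtop := pAdjoin_eq_top_of_adjoin_eq_top (k := k) p hT
  obtain ⟨S, -, hS, hTS⟩ := exists_isPFree_subset (p := p) T
  -- `F = F^p(S)` as well
  have hStop : pAdjoin p (↑S : Set F) = ⊤ := by
    rw [eq_top_iff, ← hTtop, pAdjoin, Subfield.closure_le]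
    refine Set.union_subset ?_ hTS
    rintro x ⟨y, rfl⟩
    rw [frobenius_def]
    exact pow_mem_pAdjoin _ y
  obtain ⟨δ, hδ⟩ := exists_dual_derivation hS
  refine ⟨S.card, fun l => δ ((S.equivFin.symm l : S) : F), fun z => ⟨fun h => ?_, ?_⟩⟩
  · refine mem_frobenius_of_forall_dual_eq_zero p hδ hStop fun s hs => ?_
    have h' := h (S.equivFin ⟨s, hs⟩)
    dsimp only at h'
    rwa [Equiv.symm_apply_apply] at h'
  · rintro ⟨y, hy⟩ l
    exact apply_eq_zero_of_pow_eq p _ hy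

variable (k) in
/-- **P, `EssFiniteType` form** (Mathlib's spelling of «`F` finitely generated over `k`»,
`IntermediateField.fg_top`; `k` explicit). [cite: Matsumura1987, §26 p. 202 and Thm. 26.5] [folklore] -/
theorem exists_derivation_commonKernel [PerfectField k] [Algebra.EssFiniteType k F] :
    ∃ (e : ℕ) (D : Fin e → Derivation ℤ F F), ∀ z : F, (∀ l, D l z = 0) ↔ ∃ y : F, y ^ p = z :=
  exists_derivation_commonKernel_of_fg p (IntermediateField.fg_top k F)

variable (k) in
/-- **P at the residue field of a local ring essentially of finite type over a perfect field** (the shape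
`GeoDictFin` consumes: the members of the steered run are local rings of finitely generated models —
localisations of finitely generated `k`-algebras — so their residue fields are finitely generated over the
perfect ground field `k`; the characteristic is read off `k`). [cite: Matsumura1987, §26 p. 202 and
Thm. 26.5] [folklore] -/
theorem exists_derivation_commonKernel_residueField [CharP k p] [PerfectField k] {T : Type*}
    [CommRing T] [IsLocalRing T] [Algebra k T] [Algebra.EssFiniteType k T] :
    ∃ (e : ℕ) (D : Fin e → Derivation ℤ (IsLocalRing.ResidueField T) (IsLocalRing.ResidueField T)),
      ∀ z : IsLocalRing.ResidueField T, (∀ l, D l z = 0) ↔ ∃ y : IsLocalRing.ResidueField T, y ^ p = z := by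
  haveI : CharP (IsLocalRing.ResidueField T) p :=
    charP_of_injective_algebraMap (algebraMap k (IsLocalRing.ResidueField T)).injective p
  haveI : Algebra.EssFiniteType k (IsLocalRing.ResidueField T) :=
    inferInstanceAs (Algebra.EssFiniteType k (T ⧸ IsLocalRing.maximalIdeal T))
  exact exists_derivation_commonKernel k p

variable (k) in
/-- **P at a localisation at a prime of a finitely generated algebra over a perfect field**, read on the
residue field of the local ring (any `T` with `[IsLocalization.AtPrime T P]`, e.g. the chain rings
`locChar` of the G-dictionary; `[IsLocalRing T]` is `IsLocalization.AtPrime.isLocalRing T P`). [cite: Matsumura1987, §26 p. 202 and Thm. 26.5] [folklore] -/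
theorem exists_derivation_commonKernel_residueField_atPrime [CharP k p] [PerfectField k] {A : Type*}
    [CommRing A] [Algebra k A] [Algebra.FiniteType k A] (P : Ideal A) [P.IsPrime] {T : Type*} [CommRing T]
    [Algebra A T] [IsLocalization.AtPrime T P] [IsLocalRing T] [Algebra k T] [IsScalarTower k A T] :
    ∃ (e : ℕ) (D : Fin e → Derivation ℤ (IsLocalRing.ResidueField T) (IsLocalRing.ResidueField T)),
      ∀ z : IsLocalRing.ResidueField T, (∀ l, D l z = 0) ↔ ∃ y : IsLocalRing.ResidueField T, y ^ p = z := by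
  haveI : Algebra.EssFiniteType A T := Algebra.EssFiniteType.of_isLocalization T P.primeCompl
  haveI : Algebra.EssFiniteType k T := Algebra.EssFiniteType.comp k A T
  exact exists_derivation_commonKernel_residueField k p

omit [Fact p.Prime] [CharP F p] in
/-- **Transport of the datum along a ring isomorphism** (for consumers whose field is presented up to
`≃+*`, e.g. `κ(S 0) ≃ Frac(R ⧸ P)`): a finite derivation family with common kernel the `p`-th powers on
`F` yields one on any `F' ≃+* F`. [folklore] -/
theorem of_ringEquiv {F' : Type w} [Field F'] (e : F' ≃+* F)
    (h : ∃ (n : ℕ) (D : Fin n → Derivation ℤ F F), ∀ z : F, (∀ l, D l z = 0) ↔ ∃ y : F, y ^ p = z) :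
    ∃ (n : ℕ) (D : Fin n → Derivation ℤ F' F'), ∀ z : F', (∀ l, D l z = 0) ↔ ∃ y : F', y ^ p = z := by
  obtain ⟨n, D, hD⟩ := h
  -- `D' l := e⁻¹ ∘ D l ∘ e`
  let φ : Fin n → F' →ₗ[ℤ] F' := fun l =>
    (e.symm.toAddMonoidHom.comp ((D l).toLinearMap.toAddMonoidHom.comp e.toAddMonoidHom)).toIntLinearMap
  have hφ : ∀ l x, φ l x = e.symm (D l (e x)) := fun _ _ => rfl
  let D' : Fin n → Derivation ℤ F' F' := fun l =>
    Derivation.mk' (φ l) fun x y => by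
      rw [hφ, hφ, hφ, map_mul, Derivation.leibniz, map_add, smul_eq_mul, smul_eq_mul, map_mul, map_mul,
        RingEquiv.symm_apply_apply, RingEquiv.symm_apply_apply, smul_eq_mul, smul_eq_mul]
  have hD' : ∀ l x, D' l x = e.symm (D l (e x)) := fun _ _ => rfl
  refine ⟨n, D', fun z => ⟨fun hz => ?_, ?_⟩⟩
  · have hz' : ∀ l, D l (e z) = 0 := fun l => by
      have h0 := hz l
      rw [hD'] at h0
      exact (map_eq_zero_iff e.symm e.symm.injective).mp h0
    obtain ⟨y, hy⟩ := (hD (e z)).mp hz'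
    refine ⟨e.symm y, ?_⟩
    apply e.injective
    rw [map_pow, e.apply_symm_apply, hy]
  · rintro ⟨y, rfl⟩ l
    rw [hD', map_pow, ((hD _).mpr ⟨e y, rfl⟩ l : D l (e y ^ p) = 0), map_zero]

/-- **P · `FGFieldPBasisDual`, LITERAL** (body of `SteeredTwo.FGFieldPBasisDual` of
`R2TwoSigma-r19.snippet.lean` v8 l.525, verbatim): a finitely generated field extension `F` of a perfect
field of characteristic `p` carries a finite family of derivations whose common kernel is exactly `F^p`.
Closes the snippet's `def FGFieldPBasisDual : Prop` by `exact`. [cite: Matsumura1987, §26 p. 202 and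
Thm. 26.5] [folklore] -/
theorem fgFieldPBasisDual :
    ∀ p : ℕ, p.Prime → ∀ (k F : Type) [Field k] [CharP k p] [PerfectField k] [Field F] [Algebra k F],
      (⊤ : IntermediateField k F).FG →
      ∃ (e : ℕ) (D : Fin e → Derivation ℤ F F), ∀ z : F, (∀ l, D l z = 0) ↔ ∃ y : F, y ^ p = z := by
  intro p hp k F _ _ _ _ _ hfg
  haveI : Fact p.Prime := ⟨hp⟩
  haveI : CharP F p := charP_of_injective_algebraMap (algebraMap k F).injective p
  exact exists_derivation_commonKernel_of_fg p hfg

/-! ## The size-pinned form: `[F : F^p] = p ^ e` gives a kernel-exact family of EXACTLY `e` derivations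

(res-L0-w41-idea-1, addendum §σ2.13 to the snippet, 2026-08-27T06:12Z: the K-slot at fixed `p`-rank wants
the family size pinned — P⁺ `FGFieldPBasisDualAt` under package (I), `FinrankDerivationAdapter` under
package (II). Both are the following statement, which needs NO ground field: a `p`-free `S` with
`F = F^p(S)` is `p`-independent over `F^p` (tree `PIndependence.lean`, exchange lemma), so
`[F : F^p] = p ^ #S` and `#S` is read off the `p`-degree.) -/

/-- `F^p(t)` as an intermediate field over the subfield `F^p` and as the subfield `pAdjoin p t` have the
same elements. [folklore] -/
theorem mem_adjoin_fieldRange_iff {t : Set F} {x : F} :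
    x ∈ IntermediateField.adjoin (frobenius F p).fieldRange t ↔ x ∈ pAdjoin p t := by
  have hr : Set.range (algebraMap (frobenius F p).fieldRange F) = Set.range (frobenius F p) := by
    ext y
    constructor
    · rintro ⟨c, rfl⟩
      obtain ⟨w, hw⟩ := RingHom.mem_fieldRange.mp c.2
      exact ⟨w, hw⟩
    · rintro ⟨w, rfl⟩
      exact ⟨⟨frobenius F p w, RingHom.mem_fieldRange.mpr ⟨w, rfl⟩⟩, rfl⟩
  have h : (IntermediateField.adjoin (frobenius F p).fieldRange t).toSubfield = pAdjoin p t := by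
    rw [IntermediateField.adjoin_toSubfield, hr, pAdjoin]
  rw [← IntermediateField.mem_toSubfield, h]

/-- **A `p`-free finite set is `p`-independent over `F^p`** (Matsumura's sense:
`[F^p(t) : F^p] = p ^ #t` for every `t ⊆ S`), by the exchange lemma `isPIndependent_insert` of the tree.
[cite: Matsumura1987, §26 p. 202] [folklore] -/
theorem isPIndependent_of_isPFree {S : Finset F} (hS : IsPFree p S) :
    Literature.AlgebraicGeometry.Resolution.IsPIndependent (F := (frobenius F p).fieldRange) p
      (↑S : Set F) := by
  classical
  suffices h : ∀ t : Finset F, t ⊆ S →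
      Literature.AlgebraicGeometry.Resolution.IsPIndependent (F := (frobenius F p).fieldRange) p
        (↑t : Set F) from
    fun t ht => (h t fun x hx => ht hx) t subset_rfl
  intro t
  induction t using Finset.induction_on with
  | empty =>
    intro _
    rw [Finset.coe_empty]
    exact Literature.AlgebraicGeometry.Resolution.isPIndependent_empty _ p
  | insert a t hat ih =>
    intro hts
    have hts' : t ⊆ S := fun x hx => hts (Finset.mem_insert_of_mem hx)
    have has : a ∈ S := hts (Finset.mem_insert_self a t)
    rw [Finset.coe_insert]
    refine Literature.AlgebraicGeometry.Resolution.isPIndependent_insert (ih hts') ?_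
      ⟨⟨a ^ p, RingHom.mem_fieldRange.mpr ⟨a, frobenius_def ..⟩⟩, rfl⟩
    intro hmem
    refine hS a has (pAdjoin_mono ?_ ((mem_adjoin_fieldRange_iff p).mp hmem))
    intro x hx
    exact ⟨hts' hx, fun hxa => hat (by rwa [Set.mem_singleton_iff.mp hxa] at hx)⟩

/-- **`[F : F^p] = p ^ #S`** for a `p`-free `S` with `F = F^p(S)` (`S` is a `p`-basis).
[cite: Matsumura1987, §26 p. 202] [folklore] -/
theorem finrank_eq_pow_card_of_isPFree {S : Finset F} (hS : IsPFree p S)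
    (hS' : pAdjoin p (↑S : Set F) = ⊤) :
    Module.finrank (frobenius F p).fieldRange F = p ^ S.card := by
  have h1 := (isPIndependent_of_isPFree p hS).finrank_eq S subset_rfl
  have htop : IntermediateField.adjoin (frobenius F p).fieldRange (↑S : Set F) = ⊤ := by
    rw [eq_top_iff]
    intro x _
    rw [mem_adjoin_fieldRange_iff p, hS']
    trivial
  rwa [htop, IntermediateField.finrank_top'] at h1

/-- If `T` spans `F` as an `F^p`-vector space then `F = F^p(T)`. [folklore] -/
theorem pAdjoin_eq_top_of_span_eq_top {T : Set F}
    (hT : Submodule.span (frobenius F p).fieldRange T = ⊤) : pAdjoin p T = ⊤ := by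
  rw [eq_top_iff]
  rintro z -
  have hz : z ∈ Submodule.span (frobenius F p).fieldRange T := by rw [hT]; trivial
  induction hz using Submodule.span_induction with
  | mem x hx => exact subset_pAdjoin _ hx
  | zero => exact zero_mem _
  | add x y _ _ hx hy => exact add_mem hx hy
  | smul c x _ hx =>
    obtain ⟨w, hw⟩ := RingHom.mem_fieldRange.mp c.2
    have hc : ((c : F) • x) ∈ pAdjoin p T := by
      rw [smul_eq_mul, ← hw, frobenius_def]
      exact mul_mem (pow_mem_pAdjoin _ _) hx
    exact hc

/-- `F = F^p(T)` and `T ⊆ F^p(S)` give `F = F^p(S)`. [folklore] -/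
theorem pAdjoin_eq_top_of_subset {S T : Set F} (hT : pAdjoin p T = ⊤) (hTS : T ⊆ pAdjoin p S) :
    pAdjoin p S = ⊤ := by
  rw [eq_top_iff, ← hT, pAdjoin, Subfield.closure_le]
  refine Set.union_subset ?_ hTS
  rintro x ⟨y, rfl⟩
  rw [frobenius_def]
  exact pow_mem_pAdjoin _ y

/-- The common kernel of the dual derivations of a `p`-free spanning `S`, indexed through any
`σ : Fin e ≃ S`, is exactly `F^p`. [cite: Matsumura1987, §26 p. 202] [folklore] -/
theorem forall_dual_eq_zero_iff {S : Finset F} {δ : F → Derivation ℤ F F}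
    (hδ : ∀ s ∈ S, δ s s = 1 ∧ ∀ t ∈ S, t ≠ s → δ s t = 0) (hS : pAdjoin p (↑S : Set F) = ⊤)
    {e : ℕ} (σ : Fin e ≃ (S : Set F)) (z : F) :
    (∀ l, δ (σ l : F) z = 0) ↔ ∃ y : F, y ^ p = z := by
  constructor
  · intro h
    refine mem_frobenius_of_forall_dual_eq_zero p hδ hS fun s hs => ?_
    have h' := h (σ.symm ⟨s, hs⟩)
    rwa [Equiv.apply_symm_apply] at h'
  · rintro ⟨y, hy⟩ l
    exact apply_eq_zero_of_pow_eq p _ hy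

/-- **P, SIZE-PINNED form (no ground field).** If `F` has characteristic `p` and `[F : F^p] = p ^ e`, then
`F` carries EXACTLY `e` derivations whose common kernel is the set of `p`-th powers: a finite
`F^p`-spanning set contains a `p`-free `S` with `F = F^p(S)` (a `p`-basis), `p ^ #S = [F : F^p] = p ^ e`
pins `#S = e`, and the dual derivations of `S` have common kernel `F^p`. [cite: Matsumura1987, §26
p. 202 and Thm. 26.5] [folklore] -/
theorem exists_derivation_commonKernel_of_finrank_eq {e : ℕ}
    (he : Module.finrank (frobenius F p).fieldRange F = p ^ e) :
    ∃ D : Fin e → Derivation ℤ F F, ∀ z : F, (∀ l, D l z = 0) ↔ ∃ y : F, y ^ p = z := by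
  classical
  have hp : p.Prime := Fact.out
  haveI : Module.Finite (frobenius F p).fieldRange F :=
    Module.finite_of_finrank_pos (by rw [he]; exact pow_pos hp.pos e)
  obtain ⟨T, hT⟩ := Module.Finite.fg_top (R := (frobenius F p).fieldRange) (M := F)
  have hTtop := pAdjoin_eq_top_of_span_eq_top p hT
  obtain ⟨S, -, hS, hTS⟩ := exists_isPFree_subset (p := p) T
  have hStop : pAdjoin p (↑S : Set F) = ⊤ := pAdjoin_eq_top_of_subset p hTtop hTS
  have hcard : S.card = e :=
    Nat.pow_right_injective hp.two_le ((finrank_eq_pow_card_of_isPFree p hS hStop).symm.trans he)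
  obtain ⟨δ, hδ⟩ := exists_dual_derivation hS
  exact ⟨fun l => δ ((S.equivFinOfCardEq hcard).symm l : F),
    forall_dual_eq_zero_iff p hδ hStop (S.equivFinOfCardEq hcard).symm⟩

/-- **`FinrankDerivationAdapter`, LITERAL** (body of res-L0-w41-idea-1's
`SteeredTwo.FinrankDerivationAdapter p`, addendum §σ2.13, verbatim, universally in `p`): package (II)'s
K-side support. Closes `∀ p, FinrankDerivationAdapter p` by `exact`. [cite: Matsumura1987, §26 p. 202
and Thm. 26.5] [folklore] -/
theorem finrankDerivationAdapter :
    ∀ (p : ℕ) (_ : Fact p.Prime) (κ : Type) [Field κ] [CharP κ p] (e : ℕ),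
      Module.finrank (frobenius κ p).fieldRange κ = p ^ e →
      ∃ D : Fin e → Derivation ℤ κ κ, ∀ z : κ, (∀ l, D l z = 0) ↔ ∃ y : κ, y ^ p = z :=
  fun p _ κ _ _ _ he => exists_derivation_commonKernel_of_finrank_eq (F := κ) p he

/-- **P⁺ · `FGFieldPBasisDualAt`, LITERAL** (body of res-L0-w41-idea-1's `SteeredTwo.FGFieldPBasisDualAt`,
addendum §σ2.13, verbatim): package (I)'s size-pinned P (the finite-generation hypotheses are not even
needed). Closes `FGFieldPBasisDualAt` by `exact`. [cite: Matsumura1987, §26 p. 202 and Thm. 26.5]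
[folklore] -/
theorem fgFieldPBasisDualAt :
    ∀ (p : ℕ) (_ : Fact p.Prime) (k F : Type) [Field k] [CharP k p] [PerfectField k] [Field F] [CharP F p]
      [Algebra k F], (⊤ : IntermediateField k F).FG → ∀ d : ℕ,
      Module.finrank (frobenius F p).fieldRange F = p ^ d →
      ∃ D : Fin d → Derivation ℤ F F, ∀ z : F, (∀ l, D l z = 0) ↔ ∃ y : F, y ^ p = z :=
  fun p _ _ F _ _ _ _ _ _ _ _ hd => exists_derivation_commonKernel_of_finrank_eq (F := F) p hd

end Summit.ResolutionOfSingularities.ResolutionOfSingularities.Theorems.SwitchingDichotomy.PBasisDual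

end
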